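import Literature.Analysis.FluidPDE.NSBoundedSpatialHolderProofs
import Literature.Analysis.FluidPDE.NSSpinHeatEquationProofs
import Literature.Analysis.FluidPDE.HeatDivFormImprovementProofs
import HarnessLib

/-!
# Serrin's spatial Hölder regularity of bounded solutions: the assembly with the discharged ingredients

`Literature.Analysis.FluidPDE.NSBoundedSpatialHolder` (`FluidPDE/NSBoundedInteriorRegularity`;
Robinson–Rodrigo–Sadowski 2016, Thm. 13.7 with `q = q' = ∞`: an essentially bounded
distributional Navier–Stokes solution with `∇u ∈ L²` on a parabolic cylinder is spatially
Hölder on smaller cylinders, uniformly in time) is reduced in `FluidPDE/NSBoundedSpatialHolder`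
(`nsBoundedSpatialHolder_of`) to two named facts:

* (A) `NSBoundedVorticityBounded` — RRS Thm. 13.7, proof §13.3.2 Steps 1–2 (bounded vorticity),
  itself reduced in `FluidPDE/NSBoundedVorticityReduction` (`nsBoundedVorticityBounded_of`) to
  `NSSpinHeatEquation` — **discharged** (`NSSpinHeatEquation_holds`,
  `FluidPDE/NSSpinHeatEquationProofs`) — and `HeatDivFormInteriorImprovement` (RRS §13.3.2
  Step 2 with Thms. D.6–D.7) — **discharged** (`HeatDivFormInteriorImprovement_holds`,
  `FluidPDE/HeatDivFormImprovementProofs`);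
* (B) `LaplaceDivFormInteriorHolder` — Gilbarg–Trudinger 2001, Thm. 8.24 for `L = Δ` —
  **discharged** (`LaplaceDivFormInteriorHolder_holds`, `FluidPDE/NSBoundedSpatialHolderProofs`;
  a second, Caccioppoli-based route to the same estimate is `FluidPDE/LaplaceDivFormRoundOne` +
  `FluidPDE/LaplaceDivFormMollified`).

This file records the resulting conditional theorems and, all ingredients being discharged, the
unconditional discharges (everything proved, no definitions):

* `nsBoundedSpatialHolder_of_vorticityBounded : NSBoundedVorticityBounded → NSBoundedSpatialHolder`;
* `nsBoundedSpatialHolder_of_heatDivFormInteriorImprovement :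
    HeatDivFormInteriorImprovement → NSBoundedSpatialHolder` — the trust base of
  `NSBoundedSpatialHolder` (and through `FluidPDE/NSBoundedInteriorRegularityAssembly` of
  `NSBoundedInteriorContinuity` and `SereginSverak2009.InteriorContinuity`) is thereby the single
  named fact `HeatDivFormInteriorImprovement` (the parabolic `L^m → L^r` improvement for
  `∂ₜw - Δw = div g`).

* `NSBoundedVorticityBounded_holds : NSBoundedVorticityBounded` — the assembly
  `nsBoundedVorticityBounded_of` fed with `NSSpinHeatEquation_holds` and
  `HeatDivFormInteriorImprovement_holds` (RRS Thm. 13.7, proof §13.3.2 Steps 1–2);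
* `NSBoundedSpatialHolder_holds : NSBoundedSpatialHolder` — the one-liner
  `nsBoundedSpatialHolder_of NSBoundedVorticityBounded_holds LaplaceDivFormInteriorHolder_holds`
  (equivalently `nsBoundedSpatialHolder_of_heatDivFormInteriorImprovement
  HeatDivFormInteriorImprovement_holds`): Serrin's theorem in the form RRS Thm. 13.7 with
  `q = q' = ∞` is thereby a theorem of the tree, with no named fact in its trust base.

## References

* J. C. Robinson, J. L. Rodrigo, W. Sadowski, *The Three-Dimensional Navier–Stokes Equations.
  Classical theory* (CUP 2016), Thm. 13.7, §13.3.2 Steps 1–4 (pp. 185–189 of the held copy),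
  Thm. 12.1, App. D.3. [`RobinsonRodrigoSadowskiCUP2016`]
* J. Serrin, *On the interior regularity of weak solutions of the Navier–Stokes equations*,
  Arch. Rational Mech. Anal. 9 (1962) 187–195. [`Serrin1962`]
* D. Gilbarg, N. S. Trudinger, *Elliptic Partial Differential Equations of Second Order*
  (2001), Thm. 8.24. [`GilbargTrudinger2001`]
-/

namespace Literature.Analysis.FluidPDE

/-- **Serrin's spatial Hölder regularity, conditional on the bounded-vorticity step only**:
`NSBoundedVorticityBounded → NSBoundedSpatialHolder` (the assembly `nsBoundedSpatialHolder_of`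
fed with the discharged `LaplaceDivFormInteriorHolder_holds`).
[cite: RobinsonRodrigoSadowskiCUP2016, Thm. 13.7 (q = q' = ∞), proof §13.3.2 Steps 3–4] -/
theorem nsBoundedSpatialHolder_of_vorticityBounded (hA : NSBoundedVorticityBounded) :
    NSBoundedSpatialHolder :=
  nsBoundedSpatialHolder_of hA LaplaceDivFormInteriorHolder_holds

/-- **Serrin's spatial Hölder regularity, conditional on the parabolic improvement step only**:
`HeatDivFormInteriorImprovement → NSBoundedSpatialHolder` (the previous theorem fed with
`nsBoundedVorticityBounded_of NSSpinHeatEquation_holds`).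
[cite: RobinsonRodrigoSadowskiCUP2016, Thm. 13.7 (q = q' = ∞), proof §13.3.2 Steps 1–4] -/
theorem nsBoundedSpatialHolder_of_heatDivFormInteriorImprovement
    (h : HeatDivFormInteriorImprovement) : NSBoundedSpatialHolder :=
  nsBoundedSpatialHolder_of_vorticityBounded (nsBoundedVorticityBounded_of NSSpinHeatEquation_holds h)

/-- **Bounded vorticity of bounded local weak solutions** (Robinson–Rodrigo–Sadowski 2016,
Thm. 13.7, proof §13.3.2 Steps 1–2, for `q = q' = ∞`): discharge of the named fact
`NSBoundedVorticityBounded` (`FluidPDE/NSBoundedSpatialHolder`) — the assembly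
`nsBoundedVorticityBounded_of` (`FluidPDE/NSBoundedVorticityReduction`: three rounds
`L² → L³ → L⁶ → L^∞` of the parabolic improvement on shrinking cylinders) fed with the discharged
`NSSpinHeatEquation_holds` and `HeatDivFormInteriorImprovement_holds`.
[cite: RobinsonRodrigoSadowskiCUP2016, Thm. 13.7, proof §13.3.2 Steps 1–2 with (13.17) (q = q' = ∞)] -/
theorem NSBoundedVorticityBounded_holds : NSBoundedVorticityBounded :=
  nsBoundedVorticityBounded_of NSSpinHeatEquation_holds HeatDivFormInteriorImprovement_holds

/-- **Serrin's spatial Hölder regularity of bounded local weak solutions, uniformly in time**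
(Serrin 1962; Robinson–Rodrigo–Sadowski 2016, Thm. 13.7 with `q = q' = ∞` and its proof,
§13.3.2 Steps 1–4): discharge of the named fact `NSBoundedSpatialHolder`
(`FluidPDE/NSBoundedInteriorRegularity`) — the assembly `nsBoundedSpatialHolder_of`
(`FluidPDE/NSBoundedSpatialHolder`) fed with `NSBoundedVorticityBounded_holds` and the elliptic
estimate `LaplaceDivFormInteriorHolder_holds` (Gilbarg–Trudinger 2001, Thm. 8.24 for `L = Δ`).
[cite: RobinsonRodrigoSadowskiCUP2016, Thm. 13.7 (q = q' = ∞) with its proof §13.3.2, Steps 1–4, (13.18)–(13.19)] -/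
theorem NSBoundedSpatialHolder_holds : NSBoundedSpatialHolder :=
  nsBoundedSpatialHolder_of NSBoundedVorticityBounded_holds LaplaceDivFormInteriorHolder_holds

end Literature.Analysis.FluidPDE
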